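import Summits.AtomisticToContinuum.Crystallization.Theorems.ChargedEnergyGapSphereCell
import HarnessLib

/-!
# §113F «SphereRows» — the nine rows of a sphere cell as pool data, and the SPHERE UNIT (lens-3 g94, line 14231 ChargedEnergyGap /
PricedLinkCensus r3, deciding leaf (T¹ᶜ) `StencilChartLawQ 130 (1/60000000) 160 (3/100) (679/1000) (691/1000)`)

Imports NODE 113E «SphereCell» (tree).  NODE 113E dispatches every chart-realisable positive chamber tuple with `ρ ∈ [ρ0, ρ1]` to a CELL
`c = [l, h] ⊆ [0,1]³` of a kernel-checked cover of `S²₊` containing `(|u 0|, |u 1|, |u 2|)` (`u` = the unit direction of the centre vertex)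
and hands it NINE VALID INEQUALITIES: per axis `a` the lower-gap row `D_(a,T) − D_C + 2·l_a·ρ0·x_C ≤ ρ1²` (= 113D `eikRow a l_a`) and for
both poles `b` the upper row `D_(a,b) − D_C − 2·h_a·ρ1·x_C ≤ ρ1²` (`D` = squared depths, `x_C = dt 0`).

§113F.1 types the nine rows as POOL DATA `sphRows c ρ0 ρ1 : List LRow` (always nine rows, fixed order: the three lower-gap rows of axes
`0,1,2`, then the upper rows of slots `(0,T),(0,F),(1,T),(1,F),(2,T),(2,F)`), proves their form at the valuation of a tuple and that the
cell hypotheses of 113E discharge them (`sphRows_holds`), and restates 113D `sound_dietX` with `extra := sphRows cell ρ0 ρ1`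
(`StationCert.sound_dietSph`): ONE station certificate checked by `checkDX` proves (T¹ᶜ) on its box ∩ chamber ∩ {tuples whose direction
lies in the cell}.

§113F.2 is the SPHERE UNIT `SphUnit`: ONE H-description `R` (box, tangents, oracle rows), ONE unit `u`, cap data and ONE diet certificate
`X` shared by a list of CELL PARTS (cell + its own LP bases / box leaves / BSP tree / leaf caps) and ONE `CoverTree`; `SphUnit.check` =
the cover checks against the parts' cells ∧ cells have nonnegative lower corners ∧ `0 ≤ ρ0` ∧ every part's station checks with its cell's
nine rows; `SphUnit.sound` = the (T¹ᶜ) inequality on slab × box ∩ chamber with NO cell hypothesis left (the binders of 113B `sound_diet`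
exactly), by 113E `sphere_cells_dispatch` + `sound_dietSph`.  A unit file is `def U : SphUnit := …`, `theorem U_ok : U.check = true := by
decide +kernel`, `theorem U_law := U.sound U_ok`; the cover (door D4) consumes `U_law` like a chamber station law.
-/

namespace Summit.AtomisticToContinuum.Crystallization.Theorems.ChargedEnergyGapChartDial

open scoped Classical
open Literature.MathematicalPhysics.StatisticalMechanics Literature.Geometry.DiscreteGeometry
open Summit.AtomisticToContinuum.Crystallization.Theses.PricedLinkCensus
open Summit.AtomisticToContinuum.Crystallization.Theorems.ChargedEnergyGapNegative

/-! ## §113F.1 The nine rows of a cell as pool data -/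
section Rows

/-- ★ THE UPPER ROW of slot `q` for a cell with upper corner coordinate `h` on axis `q.1` (valuation indices: depth `0` = centre, square
`7 + slotIx q`, square `7` = centre): `D_q − D_C − 2·h·ρ1·x_C ≤ ρ1²`. -/
def sphUpRow (q : Fin 3 × Bool) (h ρ1 : ℚ) : LRow :=
  ⟨axpy 1 (unitRow (7 + slotIx q) 1) (axpy 1 (unitRow 7 (-1)) (unitRow 0 (-(2 * h * ρ1)))), ρ1 ^ 2⟩

/-- [formal bookkeeping] the upper row's form at the valuation of a tuple. -/
theorem linAt_sphUpRow (q : Fin 3 × Bool) (h ρ1 : ℚ) (dt : (Fin 3 → ℤ) → ℝ) :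
    linAt (sphUpRow q h ρ1).a (sval dt) 0 = dt (holeVertex 0 q) ^ 2 - dt 0 ^ 2 - 2 * (h : ℝ) * ρ1 * dt 0 := by
  have e1 : sval dt (7 + slotIx q) = dt (holeVertex 0 q) ^ 2 := by
    rw [show 7 + slotIx q = 7 + ptIx (some q) from rfl, sval_sq, stPt_some]
  have e2 : sval dt 7 = dt 0 ^ 2 := by rw [show (7 : ℕ) = 7 + ptIx none from rfl, sval_sq, stPt_none]
  have e3 : sval dt 0 = dt 0 := by rw [show (0 : ℕ) = ptIx none from rfl, sval_pt, stPt_none]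
  simp only [sphUpRow, linAt_axpy, linAt_unitRow]
  rw [e1, e2, e3]
  push_cast
  ring

/-- ★ The cell's upper hypothesis for slot `q` discharges the upper row. -/
theorem sphUpRow_holds {q : Fin 3 × Bool} {h ρ1 : ℚ} {dt : (Fin 3 → ℤ) → ℝ}
    (hh : dt (holeVertex 0 q) ^ 2 - dt 0 ^ 2 - 2 * (h : ℝ) * ρ1 * dt 0 ≤ (ρ1 : ℝ) ^ 2) :
    linAt (sphUpRow q h ρ1).a (sval dt) 0 ≤ ((sphUpRow q h ρ1).b : ℝ) := by
  rw [linAt_sphUpRow]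
  simp only [sphUpRow]
  push_cast
  exact hh

/-- ★ THE NINE ROWS OF A CELL `c = [l, h]` as pool data (fixed order): the lower-gap rows `eikRow a (c.lo a) ρ0 ρ1` of axes `0, 1, 2`, then
the upper rows of slots `(0,T), (0,F), (1,T), (1,F), (2,T), (2,F)`. -/
def sphRows (c : Box3) (ρ0 ρ1 : ℚ) : List LRow :=
  [eikRow 0 c.l0 ρ0 ρ1, eikRow 1 c.l1 ρ0 ρ1, eikRow 2 c.l2 ρ0 ρ1,
    sphUpRow (0, true) c.h0 ρ1, sphUpRow (0, false) c.h0 ρ1, sphUpRow (1, true) c.h1 ρ1, sphUpRow (1, false) c.h1 ρ1,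
    sphUpRow (2, true) c.h2 ρ1, sphUpRow (2, false) c.h2 ρ1]

/-- [formal bookkeeping] `sphRows` has nine members. -/
theorem length_sphRows (c : Box3) (ρ0 ρ1 : ℚ) : (sphRows c ρ0 ρ1).length = 9 := rfl

/-- ★ The cell hypotheses handed out by 113E `sphere_cells_dispatch` discharge all nine rows. -/
theorem sphRows_holds {c : Box3} {ρ0 ρ1 : ℚ} {dt : (Fin 3 → ℤ) → ℝ}
    (hlo : ∀ a : Fin 3, dt (holeVertex 0 (a, true)) ^ 2 - dt 0 ^ 2 + 2 * (c.lo a : ℝ) * ρ0 * dt 0 ≤ (ρ1 : ℝ) ^ 2)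
    (hhi : ∀ (a : Fin 3) (b : Bool), dt (holeVertex 0 (a, b)) ^ 2 - dt 0 ^ 2 - 2 * (c.hi a : ℝ) * ρ1 * dt 0 ≤ (ρ1 : ℝ) ^ 2) :
    ∀ r ∈ sphRows c ρ0 ρ1, linAt r.a (sval dt) 0 ≤ (r.b : ℝ) := by
  have l0 := hlo 0
  have l1 := hlo 1
  have l2 := hlo 2
  have u0 := hhi 0
  have u1 := hhi 1
  have u2 := hhi 2
  simp only [Box3.lo_zero, Box3.lo_one, Box3.lo_two, Box3.hi_zero, Box3.hi_one, Box3.hi_two] at l0 l1 l2 u0 u1 u2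
  intro r hr
  simp only [sphRows, List.mem_cons, List.not_mem_nil, or_false] at hr
  rcases hr with rfl | rfl | rfl | rfl | rfl | rfl | rfl | rfl | rfl
  · exact eikRow_holds l0 _ (List.mem_singleton_self _)
  · exact eikRow_holds l1 _ (List.mem_singleton_self _)
  · exact eikRow_holds l2 _ (List.mem_singleton_self _)
  · exact sphUpRow_holds (u0 true)
  · exact sphUpRow_holds (u0 false)
  · exact sphUpRow_holds (u1 true)
  · exact sphUpRow_holds (u1 false)
  · exact sphUpRow_holds (u2 true)
  · exact sphUpRow_holds (u2 false)

/-- ★★★ **SOUNDNESS OF A CELL STATION**: a station certificate checked (113D `checkDX`) with the nine rows of the cell `cell` at the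
station's own `ρ`-range proves (T¹ᶜ) for the FNF chamber tuples of its box whose direction lies in the cell — i.e. under the two cell
hypotheses handed out by 113E `sphere_cells_dispatch` (with `ρ0 := c.R.rho0`, `ρ1 := c.R.rho1`). -/
theorem StationCert.sound_dietSph (c : StationCert) (X : DietCert) (cell : Box3)
    (h : c.checkDX X (sphRows cell c.R.rho0 c.R.rho1) = true) :
    ∀ ρ : ℝ, (c.R.rho0 : ℝ) ≤ ρ → ρ ≤ c.R.rho1 → ∀ dt : (Fin 3 → ℤ) → ℝ,
      (∀ q, castW c.R.lo q ≤ dt (holeVertex 0 q) ∧ dt (holeVertex 0 q) ≤ castW c.R.hi q) → ((c.R.loC : ℝ) ≤ dt 0 ∧ dt 0 ≤ c.R.hiC) →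
      IsChartRealisable ρ dt → (∀ p ∈ stencil 0, 0 < dt p) → poleSum dt 0 ≤ poleSum dt 1 → poleSum dt 0 ≤ poleSum dt 2 →
      (∀ a : Fin 3, dt (holeVertex 0 (a, true)) ≤ dt (holeVertex 0 (a, false))) →
      (∀ a : Fin 3, dt (holeVertex 0 (a, true)) ^ 2 - dt 0 ^ 2 + 2 * (cell.lo a : ℝ) * c.R.rho0 * dt 0 ≤ (c.R.rho1 : ℝ) ^ 2) →
      (∀ (a : Fin 3) (b : Bool), dt (holeVertex 0 (a, b)) ^ 2 - dt 0 ^ 2 - 2 * (cell.hi a : ℝ) * c.R.rho1 * dt 0 ≤ (c.R.rho1 : ℝ) ^ 2) →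
      feetHoleCost 160 (3 / 100) ρ dt 0 ≤ domCapK c.u 160 (3 / 100) ρ (chargeDepth ρ dt 0) :=
  fun ρ h₀ h₁ dt hbox hC hreal hpos hch1 hch2 hchp hlo hhi =>
    c.sound_dietX X _ h ρ h₀ h₁ dt hbox hC hreal hpos hch1 hch2 hchp (sphRows_holds hlo hhi)

end Rows

/-! ## §113F.2 The sphere unit: one box, one cover, one station certificate per cell -/
section Unit

/-- A CELL PART: a cell of the cover together with the cell-specific half of its station certificate (LP bases, box leaves, BSP tree,
leaf caps); the H-description, unit, caps and diet rows are shared by the unit. -/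
structure CellPart where
  /-- the cell `[l, h] ⊆ [0,1]³` -/
  cell : Box3
  /-- LP bases -/
  bases : List BasisCert
  /-- box leaves -/
  boxes : List BoxLeaf
  /-- the partition tree -/
  tree : Bsp Leaf
  /-- leaf-local caps -/
  caps : List LeafCap

/-- ★ A SPHERE UNIT: ONE box / H-description `R`, unit `u`, cap data, diet certificate `X` and cover `cover`, and one `CellPart` per cell. -/
structure SphUnit where
  /-- the shared H-description (110D) -/
  R : StationRowsCert
  /-- the unit of `domCapK` -/
  u : ℚ
  /-- certified cap lower bound (in units of `u`) -/
  capLB : ℚ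
  /-- the three axis cap certificates (108C) -/
  cap : Fin 3 → AxisCap
  /-- the shared diet rows (113B) -/
  X : DietCert
  /-- the cover certificate of `S²₊ ∩ [0,1]³` by the parts' cells (113E) -/
  cover : CoverTree
  /-- the cell parts -/
  parts : List CellPart

/-- The station certificate of a part: shared data from the unit, partition data from the part. -/
def SphUnit.station (U : SphUnit) (P : CellPart) : StationCert :=
  ⟨U.R, U.u, U.capLB, U.cap, P.bases, P.boxes, P.tree, P.caps⟩

/-- The unit's cell list (in part order; the cover's `cell j` leaves refer to these indices). -/
def SphUnit.cells (U : SphUnit) : List Box3 := U.parts.map CellPart.cell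

/-- ★ THE UNIT CHECKER: the cover checks against the cells, the cells have nonnegative lower corners, `0 ≤ ρ0`, and every part's station
checks (113D `checkDX`) with the nine rows of its cell. -/
def SphUnit.check (U : SphUnit) : Bool :=
  U.cover.check U.cells unitCube && U.cells.all (fun c => decide (0 ≤ c.l0 ∧ 0 ≤ c.l1 ∧ 0 ≤ c.l2)) && decide (0 ≤ U.R.rho0) &&
    U.parts.all (fun P => (U.station P).checkDX U.X (sphRows P.cell U.R.rho0 U.R.rho1))

/-- ★★★ **SOUNDNESS OF A SPHERE UNIT**: a checked unit proves the (T¹ᶜ) inequality for EVERY FNF chamber tuple of its slab × box — the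
binders are exactly those of 113B `StationCert.sound_diet` (no cell hypothesis remains): 113E `sphere_cells_dispatch` places the tuple's
direction in some part's cell, whose checked station closes it by `sound_dietSph`. -/
theorem SphUnit.sound (U : SphUnit) (h : U.check = true) :
    ∀ ρ : ℝ, (U.R.rho0 : ℝ) ≤ ρ → ρ ≤ U.R.rho1 → ∀ dt : (Fin 3 → ℤ) → ℝ,
      (∀ q, castW U.R.lo q ≤ dt (holeVertex 0 q) ∧ dt (holeVertex 0 q) ≤ castW U.R.hi q) → ((U.R.loC : ℝ) ≤ dt 0 ∧ dt 0 ≤ U.R.hiC) →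
      IsChartRealisable ρ dt → (∀ p ∈ stencil 0, 0 < dt p) → poleSum dt 0 ≤ poleSum dt 1 → poleSum dt 0 ≤ poleSum dt 2 →
      (∀ a : Fin 3, dt (holeVertex 0 (a, true)) ≤ dt (holeVertex 0 (a, false))) →
      feetHoleCost 160 (3 / 100) ρ dt 0 ≤ domCapK U.u 160 (3 / 100) ρ (chargeDepth ρ dt 0) := by
  simp only [SphUnit.check, Bool.and_eq_true, decide_eq_true_eq] at h
  obtain ⟨⟨⟨hT, hnn⟩, hρ0⟩, hall⟩ := h
  intro ρ h₀ h₁ dt hbox hC hreal hpos hch1 hch2 hchp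
  obtain ⟨c, hc, hlo, hhi⟩ := sphere_cells_dispatch U.cells U.cover hT hnn hreal h₀ h₁ (by exact_mod_cast hρ0) hpos hchp
  obtain ⟨P, hP, rfl⟩ := List.mem_map.1 hc
  have hchk : (U.station P).checkDX U.X (sphRows P.cell U.R.rho0 U.R.rho1) = true := List.all_eq_true.mp hall P hP
  exact (U.station P).sound_dietSph U.X P.cell hchk ρ h₀ h₁ dt hbox hC hreal hpos hch1 hch2 hchp hlo hhi

/-- ★ BATCH FORM over a list of checked units (one Boolean conjunction per file; the cover cites the member's law). -/
theorem SphUnit.sound_of_all {Us : List SphUnit} (h : Us.all SphUnit.check = true) {U : SphUnit} (hU : U ∈ Us) :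
    ∀ ρ : ℝ, (U.R.rho0 : ℝ) ≤ ρ → ρ ≤ U.R.rho1 → ∀ dt : (Fin 3 → ℤ) → ℝ,
      (∀ q, castW U.R.lo q ≤ dt (holeVertex 0 q) ∧ dt (holeVertex 0 q) ≤ castW U.R.hi q) → ((U.R.loC : ℝ) ≤ dt 0 ∧ dt 0 ≤ U.R.hiC) →
      IsChartRealisable ρ dt → (∀ p ∈ stencil 0, 0 < dt p) → poleSum dt 0 ≤ poleSum dt 1 → poleSum dt 0 ≤ poleSum dt 2 →
      (∀ a : Fin 3, dt (holeVertex 0 (a, true)) ≤ dt (holeVertex 0 (a, false))) →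
      feetHoleCost 160 (3 / 100) ρ dt 0 ≤ domCapK U.u 160 (3 / 100) ρ (chargeDepth ρ dt 0) :=
  U.sound (List.all_eq_true.mp h U hU)

end Unit

end Summit.AtomisticToContinuum.Crystallization.Theorems.ChargedEnergyGapChartDial
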